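import Literature.AnabelianGeometry.EtaleTheta.Discharge.Sec1Thm16iiHVOfUnitsTransport
import Literature.AnabelianGeometry.EtaleTheta.Thm16SubdagFdd2Transport
import HarnessLib

/-!
# [EtTh] Thm. 1.6 (ii), junction link (J0): the Galois isomorphism `G_{K̈α} →̃ G_{K̈β}` INSIDE `G_{ℚ_p}` induced by `γ` on
# `Π^tp_Ÿ` ([AbsAnab] Lem. 1.3.8 descent), and `hV` for Kummer cores from `(γ, hΔ, open augmentations)` modulo `hΘι`

S. Mochizuki, *The étale theta function …*, Publ. RIMS **45** (2009), §1, Thm. 1.6 (ii) p. 24 [cite: MochizukiEtTh2009, Thm 1.6 (ii) p.24];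
the descent step is [AbsAnab] Lem. 1.3.8 ("`α` induces isomorphisms `Δ_{X₁} ≅ Δ_{X₂}`, `G₁ ≅ G₂`"). Layer L2 of the abc-iut cell,
seat abc-iut-L2-t1 (gen 12; FILE 3 of abc-iut-L2-lead R1194/R1221 «T16II-HV»). PROOF-ONLY (no `def`, no instance, no `Prop` fact),
over FILE 2 (`Sec1Thm16iiHVOfUnitsTransport`: `KummerCore.hV_of_unitsTransport`, `aug_mem_fixingSubgroup`), following the pattern of
abc-iut-L2-t3's `TemperedArithmeticGroup.exists_galoisContinuousEquiv_of_map_delta` (`BiKummerThm44SubGaloisDescent`) — BY NAME.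

RESULTS. For theta settings with Kummer cores `Cα`, `Cβ` and `γ : Π^tp_{Xα} →̃ Π^tp_{Xβ}` with Thm. 1.6 (i) `h` and `hΔ : γ(Δ^tp_α) = Δ^tp_β`:
* `KummerCore.aug_gamma_eq_of_aug_eq` — `aug_β(γ y)` depends only on `aug_α(y)` (`Δ^tp = Ker aug`);
* `KummerCore.isOpen_GtpYdd` — `Π^tp_Ÿ` is open (`K̈/ℚ_p` finite for a core); `KummerCore.exists_mem_GtpYdd_aug_eq` — `aug : Π^tp_Ÿ ↠ G_K̈`;
* **`KummerCore.exists_galoisIso_of_thm16i`** — when both augmentations are OPEN maps (binders `haugα`, `haugβ`, the tree's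
  standing hypothesis «`Π^tp_X ↠ G_K` is open», true at the models), there is `αG : G_{K̈α} ≃ₜ* G_{K̈β}` (subgroups of `G_{ℚ_p}`,
  subspace topologies) with `αG(aug_α y) = aug_β(γ y)` for `y ∈ Π^tp_{Ÿα}` — the hypothesis `hαG` of FILE 2;
* **`KummerCore.hV_of_thm16i`** — hence the `hV` binder of `Thm16Sub.thm16ii_of_prop15ii` for cores from `(h, hΔ, haugα, haugβ)`
  modulo the cyclotomic-rigidity junction `hΘι` (for the `ψ` produced by abc-iut-L4's `Prop121vii.unitsTransport_holds`);
  `hV_of_thm16i_of_forall` — the same with `hΘι` in UNIVERSAL form (over all `ψ` with the three [AbsAnab] 1.2.1 (vii) properties — unique by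
  abc-iut-L4's `unitsTransport_unique`), giving `hV` CLOSED; and **`KummerCore.thm16ii_toKummerData_of_cyclotomicRigidity`** — THE NODE'S
  PREDICATE `ThetaSetting.Thm16ii γ h Cα.toKummerData Cβ.toKummerData canonical canonical` from {c, h, hΔ, Compat ×2, Prop15ii ×2, open aug ×2, hΘι}.
HONEST FRAMING: statements about the typed interface; `hΔ`, `haug*`, `hΘι` explicit hypotheses; nothing of [EtTh] is asserted;
no side is taken on [IUTchIII] Cor. 3.12; typed ≠ proved.
-/

noncomputable section

namespace Literature.AnabelianGeometry.EtaleTheta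

open Literature.AnabelianGeometry.SemiGraphs Topology
open scoped IsMulCommutative

namespace ThetaSetting.KummerCore

variable {p : ℕ} [Fact p.Prime] {Dα Dβ : ThetaSetting p} {γ : Dα.PiTemp ≃ₜ* Dβ.PiTemp}

/-! ### Descent along the augmentation -/

/-- **`aug_β(γ y)` depends only on `aug_α(y)`** when `γ(Δ^tp_α) = Δ^tp_β` (`Δ^tp = Ker aug`): [AbsAnab] Lem. 1.3.8 «well-defined».
[cite: MochizukiAbsAnab2004, Lemma 1.3.8 p.18] -/
theorem aug_gamma_eq_of_aug_eq (hΔ : Dα.DeltaTemp.map γ.toMulEquiv.toMonoidHom = Dβ.DeltaTemp) {y y' : Dα.PiTemp}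
    (he : Dα.aug y = Dα.aug y') : Dβ.aug (γ y) = Dβ.aug (γ y') := by
  have hmem : y⁻¹ * y' ∈ Dα.DeltaTemp := by
    change y⁻¹ * y' ∈ Dα.aug.toMonoidHom.ker
    rw [MonoidHom.mem_ker]
    change Dα.aug (y⁻¹ * y') = 1
    rw [map_mul, map_inv, he, inv_mul_cancel]
  have hmem' : γ (y⁻¹ * y') ∈ Dβ.DeltaTemp := by
    rw [← hΔ]
    exact ⟨y⁻¹ * y', hmem, rfl⟩
  change γ (y⁻¹ * y') ∈ Dβ.aug.toMonoidHom.ker at hmem'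
  rw [MonoidHom.mem_ker] at hmem'
  change Dβ.aug (γ (y⁻¹ * y')) = 1 at hmem'
  rw [map_mul, map_inv, map_mul, map_inv, inv_mul_eq_one] at hmem'
  exact hmem'

/-- `γ⁻¹(Δ^tp_β) = Δ^tp_α`. [cite: MochizukiAbsAnab2004, Lemma 1.3.8 p.18] -/
theorem map_symm_deltaTemp (hΔ : Dα.DeltaTemp.map γ.toMulEquiv.toMonoidHom = Dβ.DeltaTemp) :
    Dβ.DeltaTemp.map γ.symm.toMulEquiv.toMonoidHom = Dα.DeltaTemp := by
  rw [← hΔ, Subgroup.map_map]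
  convert Subgroup.map_id Dα.DeltaTemp
  ext x
  exact γ.toMulEquiv.symm_apply_apply x

/-- Thm. 1.6 (i) for `γ⁻¹`. [cite: MochizukiEtTh2009, Thm 1.6 (i) p.24] -/
theorem thm16i_symm (h : Thm16i γ) : Thm16i γ.symm := by
  change Dβ.GtpYdd.map γ.symm.toMulEquiv.toMonoidHom = Dα.GtpYdd
  rw [← h, Subgroup.map_map]
  convert Subgroup.map_id Dα.GtpYdd
  ext x
  exact γ.toMulEquiv.symm_apply_apply x

/-- `γ(Π^tp_{Ÿα}) ⊆ Π^tp_{Ÿβ}`, membership form. [cite: MochizukiEtTh2009, Thm 1.6 (i) p.24] -/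
theorem gamma_mem_GtpYdd (h : Thm16i γ) {y : Dα.PiTemp} (hy : y ∈ Dα.GtpYdd) : γ y ∈ Dβ.GtpYdd := by
  have : γ y ∈ Dα.GtpYdd.map γ.toMulEquiv.toMonoidHom := ⟨y, hy, rfl⟩
  rwa [h] at this

/-- **`Π^tp_Ÿ` is open** for a setting with a Kummer core (`Π^tp_Ÿ = Π^tp_{Y₂} ∩ aug⁻¹(G_K̈)`, `G_K̈` open as `K̈/ℚ_p` is finite).
[cite: MochizukiEtTh2009, §1 p.17] -/
theorem isOpen_GtpYdd {D : ThetaSetting p} (C : D.KummerCore) : IsOpen (D.GtpYdd : Set D.PiTemp) := by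
  haveI : FiniteDimensional ℚ_[p] D.Kdd := C.finiteDimensional_Kdd
  change IsOpen ((D.GtpYN (2 * 1) ⊓ (D.GJddN 1).comap D.aug.toMonoidHom : Subgroup D.PiTemp) : Set D.PiTemp)
  rw [D.GJddN_one]
  refine (D.isOpen_GtpYN _).inter ?_
  exact (IntermediateField.fixingSubgroup_isOpen D.Kdd).preimage (map_continuous D.aug)

/-- **`aug : Π^tp_Ÿ ↠ G_K̈`** (the Galois image of a core, `map_augTheta_gtpYdd`). [cite: MochizukiEtTh2009, Prop 1.5 p.23] -/
theorem exists_mem_GtpYdd_aug_eq {D : ThetaSetting p} (C : D.KummerCore) (σ : ↥D.Kdd.fixingSubgroup) :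
    ∃ y ∈ D.GtpYdd, D.aug y = σ := by
  have hσ : (σ : GQp p) ∈ (D.GtpYdd.map D.toTheta).map C.augTheta := by rw [C.map_augTheta_gtpYdd]; exact σ.2
  obtain ⟨_, ⟨y, hy, rfl⟩, hσ'⟩ := hσ
  exact ⟨y, hy, by rw [← C.augTheta_toTheta]; exact hσ'⟩

/-- The corestricted augmentation `Π^tp_Ÿ → G_K̈` is an OPEN QUOTIENT MAP when `aug` is an open map.
[cite: MochizukiAbsAnab2004, Lemma 1.3.8 p.18] -/
theorem isQuotientMap_augYdd {D : ThetaSetting p} (C : D.KummerCore) (haug : IsOpenMap D.aug) :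
    IsQuotientMap (fun y : ↥D.GtpYdd => (⟨D.aug y, aug_mem_fixingSubgroup C y.2⟩ : ↥D.Kdd.fixingSubgroup)) := by
  refine IsOpenMap.isQuotientMap ?_ ?_ ?_
  · intro U hU
    have hU' : IsOpen (D.aug '' (Subtype.val '' U)) := haug _ ((isOpen_GtpYdd C).isOpenMap_subtype_val U hU)
    have hEq : (fun y : ↥D.GtpYdd => (⟨D.aug y, aug_mem_fixingSubgroup C y.2⟩ : ↥D.Kdd.fixingSubgroup)) '' U =
        Subtype.val ⁻¹' (D.aug '' (Subtype.val '' U)) := by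
      ext σ
      constructor
      · rintro ⟨y, hyU, rfl⟩
        exact ⟨y, ⟨y, hyU, rfl⟩, rfl⟩
      · rintro ⟨_, ⟨y, hyU, rfl⟩, hσ⟩
        exact ⟨y, hyU, Subtype.ext hσ⟩
    rw [hEq]
    exact hU'.preimage continuous_subtype_val
  · exact ((map_continuous D.aug).comp continuous_subtype_val).subtype_mk _
  · intro σ
    obtain ⟨y, hy, hyσ⟩ := exists_mem_GtpYdd_aug_eq C σ
    exact ⟨⟨y, hy⟩, Subtype.ext hyσ⟩

/-! ### The Galois isomorphism induced by `γ` -/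

/-- **[AbsAnab] Lem. 1.3.8 descent at `Π^tp_Ÿ`, topological form**: `γ` with Thm. 1.6 (i), `γ(Δ^tp_α) = Δ^tp_β` and OPEN
augmentations induces `αG : G_{K̈α} ≃ₜ* G_{K̈β}` inside `G_{ℚ_p}` with `αG(aug_α y) = aug_β(γ y)` on `Π^tp_{Ÿα}` — the hypothesis
`hαG` of `KummerCore.exists_psi_of_unitsTransport`. [cite: MochizukiAbsAnab2004, Lemma 1.3.8 p.18] -/
theorem exists_galoisIso_of_thm16i (h : Thm16i γ) (hΔ : Dα.DeltaTemp.map γ.toMulEquiv.toMonoidHom = Dβ.DeltaTemp)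
    (Cα : Dα.KummerCore) (Cβ : Dβ.KummerCore) (haugα : IsOpenMap Dα.aug) (haugβ : IsOpenMap Dβ.aug) :
    ∃ αG : ↥Dα.Kdd.fixingSubgroup ≃ₜ* ↥Dβ.Kdd.fixingSubgroup,
      ∀ (y : Dα.PiTemp) (hy : y ∈ Dα.GtpYdd),
        ((αG ⟨Dα.aug y, aug_mem_fixingSubgroup Cα hy⟩ : ↥Dβ.Kdd.fixingSubgroup) : GQp p) = Dβ.aug (γ y) := by
  have h' : Thm16i γ.symm := thm16i_symm h
  have hΔ' := map_symm_deltaTemp (γ := γ) hΔ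
  -- sections of the two augmentations on `Π^tp_Ÿ`
  choose sα hsα hsα' using exists_mem_GtpYdd_aug_eq Cα
  choose sβ hsβ hsβ' using exists_mem_GtpYdd_aug_eq Cβ
  -- the maps
  let f : ↥Dα.Kdd.fixingSubgroup → ↥Dβ.Kdd.fixingSubgroup := fun σ =>
    ⟨Dβ.aug (γ (sα σ)), aug_mem_fixingSubgroup Cβ (gamma_mem_GtpYdd h (hsα σ))⟩
  let g : ↥Dβ.Kdd.fixingSubgroup → ↥Dα.Kdd.fixingSubgroup := fun τ =>
    ⟨Dα.aug (γ.symm (sβ τ)), aug_mem_fixingSubgroup Cα (gamma_mem_GtpYdd h' (hsβ τ))⟩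
  have hf : ∀ (y : Dα.PiTemp) (hy : y ∈ Dα.GtpYdd),
      (f ⟨Dα.aug y, aug_mem_fixingSubgroup Cα hy⟩ : GQp p) = Dβ.aug (γ y) := fun y hy =>
    aug_gamma_eq_of_aug_eq hΔ (hsα' ⟨Dα.aug y, aug_mem_fixingSubgroup Cα hy⟩)
  have hg : ∀ (y : Dβ.PiTemp) (hy : y ∈ Dβ.GtpYdd),
      (g ⟨Dβ.aug y, aug_mem_fixingSubgroup Cβ hy⟩ : GQp p) = Dα.aug (γ.symm y) := fun y hy =>
    aug_gamma_eq_of_aug_eq hΔ' (hsβ' ⟨Dβ.aug y, aug_mem_fixingSubgroup Cβ hy⟩)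
  have hgf : ∀ σ, g (f σ) = σ := by
    intro σ
    apply Subtype.ext
    have e1 : f σ = ⟨Dβ.aug (γ (sα σ)), aug_mem_fixingSubgroup Cβ (gamma_mem_GtpYdd h (hsα σ))⟩ := rfl
    rw [e1, hg _ (gamma_mem_GtpYdd h (hsα σ)), ContinuousMulEquiv.symm_apply_apply, hsα']
  have hfg : ∀ τ, f (g τ) = τ := by
    intro τ
    apply Subtype.ext
    have e1 : g τ = ⟨Dα.aug (γ.symm (sβ τ)), aug_mem_fixingSubgroup Cα (gamma_mem_GtpYdd h' (hsβ τ))⟩ := rfl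
    rw [e1, hf _ (gamma_mem_GtpYdd h' (hsβ τ)), ContinuousMulEquiv.apply_symm_apply, hsβ']
  have hmul : ∀ σ τ, f (σ * τ) = f σ * f τ := by
    intro σ τ
    apply Subtype.ext
    have hστ : Dα.aug (sα σ * sα τ) = ((σ * τ : ↥Dα.Kdd.fixingSubgroup) : GQp p) := by
      rw [map_mul, hsα', hsα']; rfl
    have key := hf (sα σ * sα τ) (mul_mem (hsα σ) (hsα τ))
    have e2 : (⟨Dα.aug (sα σ * sα τ), aug_mem_fixingSubgroup Cα (mul_mem (hsα σ) (hsα τ))⟩ :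
        ↥Dα.Kdd.fixingSubgroup) = σ * τ := Subtype.ext hστ
    rw [e2] at key
    rw [key, map_mul, map_mul, Subgroup.coe_mul]
  -- continuity via the open quotient maps `Π^tp_Ÿ ↠ G_K̈`
  have hcf : Continuous f := by
    rw [(isQuotientMap_augYdd Cα haugα).continuous_iff]
    have hEq : f ∘ (fun y : ↥Dα.GtpYdd => (⟨Dα.aug y, aug_mem_fixingSubgroup Cα y.2⟩ : ↥Dα.Kdd.fixingSubgroup)) =
        fun y : ↥Dα.GtpYdd => (⟨Dβ.aug (γ y), aug_mem_fixingSubgroup Cβ (gamma_mem_GtpYdd h y.2)⟩ :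
          ↥Dβ.Kdd.fixingSubgroup) := funext fun y => Subtype.ext (hf y y.2)
    rw [hEq]
    exact ((map_continuous Dβ.aug).comp ((map_continuous γ).comp continuous_subtype_val)).subtype_mk _
  have hcg : Continuous g := by
    rw [(isQuotientMap_augYdd Cβ haugβ).continuous_iff]
    have hEq : g ∘ (fun y : ↥Dβ.GtpYdd => (⟨Dβ.aug y, aug_mem_fixingSubgroup Cβ y.2⟩ : ↥Dβ.Kdd.fixingSubgroup)) =
        fun y : ↥Dβ.GtpYdd => (⟨Dα.aug (γ.symm y), aug_mem_fixingSubgroup Cα (gamma_mem_GtpYdd h' y.2)⟩ :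
          ↥Dα.Kdd.fixingSubgroup) := funext fun y => Subtype.ext (hg y y.2)
    rw [hEq]
    exact ((map_continuous Dα.aug).comp ((map_continuous γ.symm).comp continuous_subtype_val)).subtype_mk _
  let e : ↥Dα.Kdd.fixingSubgroup ≃* ↥Dβ.Kdd.fixingSubgroup := MulEquiv.mk ⟨f, g, hgf, hfg⟩ hmul
  exact ⟨ContinuousMulEquiv.mk e hcf hcg, hf⟩

/-- **Thm. 1.6 (ii) `hV` for Kummer CORES from `(γ, Thm16i, hΔ, open augmentations)`, modulo the cyclotomic-rigidity junction `hΘι`**: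
FILE 2's `hV_of_unitsTransport` with its Galois-isomorphism hypothesis DISCHARGED by `exists_galoisIso_of_thm16i`. Binders left:
`hΔ` ([AbsAnab] Lem. 1.3.8, as in the Thm. 1.6 (i) cell), `haugα`/`haugβ` («`Π^tp_X ↠ G_K` open»), `hΘι` (F-1653 ⟸ F-0105 on `Δ_Θ`).
[cite: MochizukiEtTh2009, Thm 1.6 (ii) p.24] -/
theorem hV_of_thm16i (h : Thm16i γ) (c : ThetaCompanion γ)
    (hΔ : Dα.DeltaTemp.map γ.toMulEquiv.toMonoidHom = Dβ.DeltaTemp) (Cα : Dα.KummerCore) (Cβ : Dβ.KummerCore)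
    (haugα : IsOpenMap Dα.aug) (haugβ : IsOpenMap Dβ.aug) :
    ∃ ψ : (PadicAlgCl p)ˣ ≃* (PadicAlgCl p)ˣ,
      (∀ y ∈ Dα.GtpYdd, ∀ x : (PadicAlgCl p)ˣ, ψ (Dα.aug y • x) = Dβ.aug (γ y) • ψ x) ∧
      (∀ x : (PadicAlgCl p)ˣ, ‖(x : PadicAlgCl p)‖ = 1 ↔ ‖(ψ x : PadicAlgCl p)‖ = 1) ∧
      ((∀ ζ : cyclotome (PadicAlgCl p)ˣ,
          c.thetaIso (Cα.coeffHom ζ : Dα.GtpTheta) =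
            (Cβ.coeffHom (cyclotome.map (ψ : (PadicAlgCl p)ˣ →* (PadicAlgCl p)ˣ) ζ) : Dβ.GtpTheta)) →
        ∀ δ : Cα.toKummerData.KddHat ≃* Cβ.toKummerData.KddHat,
          (∀ a, transport c h (Dα.inflTheta Dα.GtpYdd (Cα.toKummerData.kumYdd a)) =
            Dβ.inflTheta Dβ.GtpYdd (Cβ.toKummerData.kumYdd (δ a))) →
          Thm16Sub.DeltaPreservesUnitsAndOne δ (ValuationHatData.canonical Cα.toKummerData)
            (ValuationHatData.canonical Cβ.toKummerData)) := by
  obtain ⟨αG, hαG⟩ := exists_galoisIso_of_thm16i h hΔ Cα Cβ haugα haugβ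
  exact hV_of_unitsTransport h c Cα Cβ αG hαG

/-! ### The node's own predicate `Thm16ii` for Kummer cores, modulo the cyclotomic-rigidity junction -/

/-- **The `hV` binder CLOSED for Kummer cores, modulo the cyclotomic-rigidity junction in UNIVERSAL form**: if EVERY
`γ`-equivariant, `‖·‖ = 1`-preserving, uniformiser-preserving `ψ : ℚ̄_p^× →̃ ℚ̄_p^×` is compatible with the companion `c` on the cyclotomes
(`hΘι`; by abc-iut-L4's `Prop121vii.unitsTransport_unique` there is exactly ONE such `ψ` for the Galois isomorphism induced by `γ`, so this is
[SemiAnbd] Thm. 6.12 for THE [AbsAnab] 1.2.1 (vii) transport — a named hypothesis, no constructor in the tree), then every `δ` with the transport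
property of Thm. 1.6 (ii)(a) satisfies `DeltaPreservesUnitsAndOne δ` (canonical valuation data). [cite: MochizukiEtTh2009, Thm 1.6 (ii) p.24] -/
theorem hV_of_thm16i_of_forall (h : Thm16i γ) (c : ThetaCompanion γ)
    (hΔ : Dα.DeltaTemp.map γ.toMulEquiv.toMonoidHom = Dβ.DeltaTemp) (Cα : Dα.KummerCore) (Cβ : Dβ.KummerCore)
    (haugα : IsOpenMap Dα.aug) (haugβ : IsOpenMap Dβ.aug)
    (hΘι : ∀ ψ : (PadicAlgCl p)ˣ ≃* (PadicAlgCl p)ˣ,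
      (∀ y ∈ Dα.GtpYdd, ∀ x : (PadicAlgCl p)ˣ, ψ (Dα.aug y • x) = Dβ.aug (γ y) • ψ x) →
      (∀ x : (PadicAlgCl p)ˣ, ‖(x : PadicAlgCl p)‖ = 1 ↔ ‖(ψ x : PadicAlgCl p)‖ = 1) →
      (∀ ϖ : (↥Dα.Kdd)ˣ, IsUniformizer Dα ϖ → ∃ ϖ' : (↥Dβ.Kdd)ˣ, IsUniformizer Dβ ϖ' ∧
        (ψ (Units.map (algebraMap (↥Dα.Kdd) (PadicAlgCl p) : ↥Dα.Kdd →* PadicAlgCl p) ϖ) : PadicAlgCl p) =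
          ((ϖ' : ↥Dβ.Kdd) : PadicAlgCl p)) →
      ∀ ζ : cyclotome (PadicAlgCl p)ˣ,
        c.thetaIso (Cα.coeffHom ζ : Dα.GtpTheta) =
          (Cβ.coeffHom (cyclotome.map (ψ : (PadicAlgCl p)ˣ →* (PadicAlgCl p)ˣ) ζ) : Dβ.GtpTheta)) :
    ∀ δ : Cα.toKummerData.KddHat ≃* Cβ.toKummerData.KddHat,
      (∀ a, transport c h (Dα.inflTheta Dα.GtpYdd (Cα.toKummerData.kumYdd a)) =
        Dβ.inflTheta Dβ.GtpYdd (Cβ.toKummerData.kumYdd (δ a))) →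
      Thm16Sub.DeltaPreservesUnitsAndOne δ (ValuationHatData.canonical Cα.toKummerData)
        (ValuationHatData.canonical Cβ.toKummerData) := by
  obtain ⟨αG, hαG⟩ := exists_galoisIso_of_thm16i h hΔ Cα Cβ haugα haugβ
  obtain ⟨ψ, hψG, hψu, hψϖ⟩ := exists_psi_of_unitsTransport (γ := γ) Cα Cβ αG hαG
  exact fun δ hδ => deltaPreservesUnitsAndOne_of_transport h c Cα Cβ ψ hψG (hΘι ψ hψG hψu hψϖ) hψu hψϖ δ hδ

/-- **[EtTh] Thm. 1.6 (ii) — THE NODE'S PREDICATE `ThetaSetting.Thm16ii` — for the Kummer data of two Kummer CORES with their canonical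
valuation data**, from: a theta companion `c`, Thm. 1.6 (i) `h`, `γ(Δ^tp_α) = Δ^tp_β` ([AbsAnab] Lem. 1.3.8), `Compat` and Prop. 1.5 (ii) on both
sides (abc-iut-L6-d5's `Thm16Sub.thm16ii_of_prop15ii`), OPEN augmentations, and the cyclotomic-rigidity junction `hΘι` in universal form
([SemiAnbd] Thm. 6.12 for the [AbsAnab] 1.2.1 (vii) transport — the ONE remaining print input BY NAME; LCFT / [AbsAnab] 1.2.1 (iv)(vi)(vii)
DISCHARGED by abc-iut-L4's theorem). [cite: MochizukiEtTh2009, Thm 1.6 (ii) p.24] -/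
theorem thm16ii_toKummerData_of_cyclotomicRigidity (c : ThetaCompanion γ) (h : Thm16i γ)
    (hΔ : Dα.DeltaTemp.map γ.toMulEquiv.toMonoidHom = Dβ.DeltaTemp) (Cα : Dα.KummerCore) (Cβ : Dβ.KummerCore)
    (hCα : Dα.Compat) (hCβ : Dβ.Compat) (h15α : Prop15ii Cα.toKummerData hCα) (h15β : Prop15ii Cβ.toKummerData hCβ)
    (haugα : IsOpenMap Dα.aug) (haugβ : IsOpenMap Dβ.aug)
    (hΘι : ∀ ψ : (PadicAlgCl p)ˣ ≃* (PadicAlgCl p)ˣ,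
      (∀ y ∈ Dα.GtpYdd, ∀ x : (PadicAlgCl p)ˣ, ψ (Dα.aug y • x) = Dβ.aug (γ y) • ψ x) →
      (∀ x : (PadicAlgCl p)ˣ, ‖(x : PadicAlgCl p)‖ = 1 ↔ ‖(ψ x : PadicAlgCl p)‖ = 1) →
      (∀ ϖ : (↥Dα.Kdd)ˣ, IsUniformizer Dα ϖ → ∃ ϖ' : (↥Dβ.Kdd)ˣ, IsUniformizer Dβ ϖ' ∧
        (ψ (Units.map (algebraMap (↥Dα.Kdd) (PadicAlgCl p) : ↥Dα.Kdd →* PadicAlgCl p) ϖ) : PadicAlgCl p) =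
          ((ϖ' : ↥Dβ.Kdd) : PadicAlgCl p)) →
      ∀ ζ : cyclotome (PadicAlgCl p)ˣ,
        c.thetaIso (Cα.coeffHom ζ : Dα.GtpTheta) =
          (Cβ.coeffHom (cyclotome.map (ψ : (PadicAlgCl p)ˣ →* (PadicAlgCl p)ˣ) ζ) : Dβ.GtpTheta)) :
    Thm16ii γ h Cα.toKummerData Cβ.toKummerData (ValuationHatData.canonical Cα.toKummerData)
      (ValuationHatData.canonical Cβ.toKummerData) :=
  Thm16Sub.thm16ii_of_prop15ii c h hΔ _ _ hCα hCβ h15α h15β _ _ (hV_of_thm16i_of_forall h c hΔ Cα Cβ haugα haugβ hΘι)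

end ThetaSetting.KummerCore

end Literature.AnabelianGeometry.EtaleTheta

end
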